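import Summits.BirchSwinnertonDyer.BirchSwinnertonDyer.Theorems.BiquadraticEisensteinDescentHeegnerTwistCouplingInSupplySymbolicMonskyClosureSymb
import HarnessLib

set_option linter.dupNamespace false -- `Summit.BirchSwinnertonDyer.BirchSwinnertonDyer.Theorems.…` (summit = sub)
set_option autoImplicit false

/-!
# Crux `HeegnerTwistCouplingInSupply` (stmt-BirchSwinnertonDyer-21381) — the closure criterion in SEMANTIC form (no oracle, no bitmask):
# staged constancy hypotheses on the reference matrix imply invertibility for every pattern

Route `BiquadraticEisensteinDescent` (cell `pub/bsd-wall`, width seat `bsd-wall-cm-bed-w3` g21; `--supports` 21381, helper). Companion of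
`…SymbolicMonskyClosure` / `…ClosureSymb` (the COMPUTABLE closure check `closureCheckRows`, certified per instance by `decide`). This file states
the same mechanism with `Prop`-valued stage hypotheses, so that a future EXISTENCE proof for symbolic bases (w3 g21 memo PATTERN-FREE-STRUCTURE §5:
every configuration with `s* = 2` owns a pattern-free recipe with two auxiliary primes; conjecturally every configuration at `t = t_pred`) can
discharge them by linear algebra instead of computation:

* ★ `det_eq_one_of_staged_constancy` (abstract): `M, M'` agree off the auxiliary block `Q` direction by direction; if (S1) every `z` killed by the
  rows of `M` outside `Q` and by the two `Q`-row sums is `Q`-constant in direction `δ₁`, (S2) every such `z` whose direction-`δ₁` rows of `M z`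
  also vanish on `Q` is `Q`-constant in direction `δ₂ ≠ δ₁`, and (S3) `M` kills no non-zero vector that is `Q`-constant in both halves, then
  `det M' = 1` — NO determinant of `M` is needed (S3 is injectivity on `Q`-constant vectors only).
* ★ `SymbData.det_monskyOddS_eq_one_of_staged_constancy` / `…Even…`: the same for the symbolic Monsky matrices of two symbol data agreeing off
  `Q × Q`, and `det_dataK_odd_of_staged_constancy` at general `k` (every mutual pattern).

HONEST FRAMING: linear algebra; proves no instance by itself; the crux (C⁺), its stubs and BSD untouched; nothing closed. THEOREMS ONLY.
Reference: [HeathBrown1994] appendix (Monsky), typescript pp. 39–41.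
-/

namespace Summit.BirchSwinnertonDyer.BirchSwinnertonDyer.Theorems.SymbolicMonsky

open Matrix

section Semantic

variable {k : ℕ}

/-- ★ **Semantic closure criterion (abstract).** See the module docstring. Directions are coded `0 = u` (half one), `1 = v` (half two),
`2 = w` (sum); `δ₁ ≠ δ₂` in `{0,1,2}`. [folklore] -/
theorem det_eq_one_of_staged_constancy (Q : Fin k → Bool) (M M' : Matrix (Fin k ⊕ Fin k) (Fin k ⊕ Fin k) (ZMod 2))
    (hout : ∀ z i, Q i = false →
      (M' *ᵥ z) (Sum.inl i) = (M *ᵥ z) (Sum.inl i) ∧ (M' *ᵥ z) (Sum.inr i) = (M *ᵥ z) (Sum.inr i))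
    (hdir : ∀ (z : Fin k ⊕ Fin k → ZMod 2) (δ : ℕ),
      (∀ i j, Q i = true → Q j = true →
        (if δ = 0 then z (Sum.inl i) else if δ = 1 then z (Sum.inr i) else z (Sum.inl i) + z (Sum.inr i)) =
        (if δ = 0 then z (Sum.inl j) else if δ = 1 then z (Sum.inr j) else z (Sum.inl j) + z (Sum.inr j))) →
      ∀ i, Q i = true →
        (if δ = 0 then (M' *ᵥ z) (Sum.inl i) else if δ = 1 then (M' *ᵥ z) (Sum.inr i)
          else (M' *ᵥ z) (Sum.inl i) + (M' *ᵥ z) (Sum.inr i)) =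
        (if δ = 0 then (M *ᵥ z) (Sum.inl i) else if δ = 1 then (M *ᵥ z) (Sum.inr i)
          else (M *ᵥ z) (Sum.inl i) + (M *ᵥ z) (Sum.inr i)))
    (hconst : ∀ z, (∀ i j, Q i = true → Q j = true → z (Sum.inl i) = z (Sum.inl j) ∧ z (Sum.inr i) = z (Sum.inr j)) →
      M' *ᵥ z = M *ᵥ z)
    (hsum : ∀ z, (∑ i ∈ Finset.univ.filter (fun i => Q i = true), (M' *ᵥ z) (Sum.inl i)) =
        (∑ i ∈ Finset.univ.filter (fun i => Q i = true), (M *ᵥ z) (Sum.inl i)) ∧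
      (∑ i ∈ Finset.univ.filter (fun i => Q i = true), (M' *ᵥ z) (Sum.inr i)) =
        (∑ i ∈ Finset.univ.filter (fun i => Q i = true), (M *ᵥ z) (Sum.inr i)))
    {δ₁ δ₂ : ℕ} (hδ₁ : δ₁ ≤ 2) (hδ₂ : δ₂ ≤ 2) (hne : δ₁ ≠ δ₂)
    (hS1 : ∀ z : Fin k ⊕ Fin k → ZMod 2,
      (∀ i, Q i = false → (M *ᵥ z) (Sum.inl i) = 0 ∧ (M *ᵥ z) (Sum.inr i) = 0) →
      (∑ i ∈ Finset.univ.filter (fun i => Q i = true), (M *ᵥ z) (Sum.inl i)) = 0 →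
      (∑ i ∈ Finset.univ.filter (fun i => Q i = true), (M *ᵥ z) (Sum.inr i)) = 0 →
      ∀ i j, Q i = true → Q j = true →
        (if δ₁ = 0 then z (Sum.inl i) else if δ₁ = 1 then z (Sum.inr i) else z (Sum.inl i) + z (Sum.inr i)) =
        (if δ₁ = 0 then z (Sum.inl j) else if δ₁ = 1 then z (Sum.inr j) else z (Sum.inl j) + z (Sum.inr j)))
    (hS2 : ∀ z : Fin k ⊕ Fin k → ZMod 2,
      (∀ i, Q i = false → (M *ᵥ z) (Sum.inl i) = 0 ∧ (M *ᵥ z) (Sum.inr i) = 0) →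
      (∑ i ∈ Finset.univ.filter (fun i => Q i = true), (M *ᵥ z) (Sum.inl i)) = 0 →
      (∑ i ∈ Finset.univ.filter (fun i => Q i = true), (M *ᵥ z) (Sum.inr i)) = 0 →
      (∀ i, Q i = true →
        (if δ₁ = 0 then (M *ᵥ z) (Sum.inl i) else if δ₁ = 1 then (M *ᵥ z) (Sum.inr i)
          else (M *ᵥ z) (Sum.inl i) + (M *ᵥ z) (Sum.inr i)) = 0) →
      ∀ i j, Q i = true → Q j = true →
        (if δ₂ = 0 then z (Sum.inl i) else if δ₂ = 1 then z (Sum.inr i) else z (Sum.inl i) + z (Sum.inr i)) =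
        (if δ₂ = 0 then z (Sum.inl j) else if δ₂ = 1 then z (Sum.inr j) else z (Sum.inl j) + z (Sum.inr j)))
    (hS3 : ∀ z : Fin k ⊕ Fin k → ZMod 2,
      (∀ i j, Q i = true → Q j = true → z (Sum.inl i) = z (Sum.inl j) ∧ z (Sum.inr i) = z (Sum.inr j)) →
      M *ᵥ z = 0 → z = 0) :
    M'.det = 1 := by
  classical
  have key : ∀ z, M' *ᵥ z = 0 → z = 0 := by
    intro z hz
    have h1 : ∀ i, Q i = false → (M *ᵥ z) (Sum.inl i) = 0 ∧ (M *ᵥ z) (Sum.inr i) = 0 := by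
      intro i hi
      obtain ⟨ha, hb⟩ := hout z i hi
      exact ⟨by rw [← ha, hz]; rfl, by rw [← hb, hz]; rfl⟩
    obtain ⟨hs1, hs2⟩ := hsum z
    have h2 : (∑ i ∈ Finset.univ.filter (fun i => Q i = true), (M *ᵥ z) (Sum.inl i)) = 0 := by
      rw [← hs1]; exact Finset.sum_eq_zero fun i _ => by rw [hz]; rfl
    have h3 : (∑ i ∈ Finset.univ.filter (fun i => Q i = true), (M *ᵥ z) (Sum.inr i)) = 0 := by
      rw [← hs2]; exact Finset.sum_eq_zero fun i _ => by rw [hz]; rfl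
    have c1 := hS1 z h1 h2 h3
    have hrow : ∀ i, Q i = true →
        (if δ₁ = 0 then (M *ᵥ z) (Sum.inl i) else if δ₁ = 1 then (M *ᵥ z) (Sum.inr i)
          else (M *ᵥ z) (Sum.inl i) + (M *ᵥ z) (Sum.inr i)) = 0 := by
      intro i hi
      rw [← hdir z δ₁ c1 i hi, hz]
      simp
    have c2 := hS2 z h1 h2 h3 hrow
    have hc := qconst_of_two_directions z hδ₁ hδ₂ hne c1 c2
    have hMz : M *ᵥ z = 0 := by rw [← hconst z hc, hz]
    exact hS3 z hc hMz
  rcases zmod_two_eq_zero_or_eq_one M'.det with h0 | h1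
  · obtain ⟨v, hv, hMv⟩ := Matrix.exists_mulVec_eq_zero_iff.mpr h0
    exact absurd (key v hMv) hv
  · exact h1

end Semantic

namespace SymbData

variable {k : ℕ} {d d' : SymbData k} {Q : Fin k → Bool}

/-- ★ **Semantic closure criterion, odd symbolic matrix**: staged constancy hypotheses (S1)–(S3) on `M_odd(d)` give `det M_odd(d') = 1` for every
`d'` agreeing with `d` off `Q × Q`. [cite: HeathBrown1994SelmerCongruentII, Appendix (Monsky), typescript p. 39 L27–L33] -/
theorem det_monskyOddS_eq_one_of_staged_constancy (h : d.AgreeOffAux Q d') {δ₁ δ₂ : ℕ} (hδ₁ : δ₁ ≤ 2) (hδ₂ : δ₂ ≤ 2) (hne : δ₁ ≠ δ₂)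
    (hS1 : ∀ z : Fin k ⊕ Fin k → ZMod 2,
      (∀ i, Q i = false → (d.monskyOddS *ᵥ z) (Sum.inl i) = 0 ∧ (d.monskyOddS *ᵥ z) (Sum.inr i) = 0) →
      (∑ i ∈ Finset.univ.filter (fun i => Q i = true), (d.monskyOddS *ᵥ z) (Sum.inl i)) = 0 →
      (∑ i ∈ Finset.univ.filter (fun i => Q i = true), (d.monskyOddS *ᵥ z) (Sum.inr i)) = 0 →
      ∀ i j, Q i = true → Q j = true →
        (if δ₁ = 0 then z (Sum.inl i) else if δ₁ = 1 then z (Sum.inr i) else z (Sum.inl i) + z (Sum.inr i)) =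
        (if δ₁ = 0 then z (Sum.inl j) else if δ₁ = 1 then z (Sum.inr j) else z (Sum.inl j) + z (Sum.inr j)))
    (hS2 : ∀ z : Fin k ⊕ Fin k → ZMod 2,
      (∀ i, Q i = false → (d.monskyOddS *ᵥ z) (Sum.inl i) = 0 ∧ (d.monskyOddS *ᵥ z) (Sum.inr i) = 0) →
      (∑ i ∈ Finset.univ.filter (fun i => Q i = true), (d.monskyOddS *ᵥ z) (Sum.inl i)) = 0 →
      (∑ i ∈ Finset.univ.filter (fun i => Q i = true), (d.monskyOddS *ᵥ z) (Sum.inr i)) = 0 →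
      (∀ i, Q i = true →
        (if δ₁ = 0 then (d.monskyOddS *ᵥ z) (Sum.inl i) else if δ₁ = 1 then (d.monskyOddS *ᵥ z) (Sum.inr i)
          else (d.monskyOddS *ᵥ z) (Sum.inl i) + (d.monskyOddS *ᵥ z) (Sum.inr i)) = 0) →
      ∀ i j, Q i = true → Q j = true →
        (if δ₂ = 0 then z (Sum.inl i) else if δ₂ = 1 then z (Sum.inr i) else z (Sum.inl i) + z (Sum.inr i)) =
        (if δ₂ = 0 then z (Sum.inl j) else if δ₂ = 1 then z (Sum.inr j) else z (Sum.inl j) + z (Sum.inr j)))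
    (hS3 : ∀ z : Fin k ⊕ Fin k → ZMod 2,
      (∀ i j, Q i = true → Q j = true → z (Sum.inl i) = z (Sum.inl j) ∧ z (Sum.inr i) = z (Sum.inr j)) →
      d.monskyOddS *ᵥ z = 0 → z = 0) :
    d'.monskyOddS.det = 1 :=
  det_eq_one_of_staged_constancy Q d.monskyOddS d'.monskyOddS (fun z i hi => h.monskyOddS_mulVec_eq_of_not_mem z i hi)
    (fun z δ hz i _ => h.drow_monskyOddS_eq z δ hz i) (fun z hz => h.monskyOddS_mulVec_eq_of_const z hz)
    (fun z => h.sum_monskyOddS_mulVec_eq z) hδ₁ hδ₂ hne hS1 hS2 hS3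

/-- ★ **Semantic closure criterion, even symbolic matrix.** [cite: HeathBrown1994SelmerCongruentII, Appendix (Monsky), typescript p. 41 L20–L36] -/
theorem det_monskyEvenS_eq_one_of_staged_constancy (h : d.AgreeOffAux Q d') {δ₁ δ₂ : ℕ} (hδ₁ : δ₁ ≤ 2) (hδ₂ : δ₂ ≤ 2) (hne : δ₁ ≠ δ₂)
    (hS1 : ∀ z : Fin k ⊕ Fin k → ZMod 2,
      (∀ i, Q i = false → (d.monskyEvenS *ᵥ z) (Sum.inl i) = 0 ∧ (d.monskyEvenS *ᵥ z) (Sum.inr i) = 0) →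
      (∑ i ∈ Finset.univ.filter (fun i => Q i = true), (d.monskyEvenS *ᵥ z) (Sum.inl i)) = 0 →
      (∑ i ∈ Finset.univ.filter (fun i => Q i = true), (d.monskyEvenS *ᵥ z) (Sum.inr i)) = 0 →
      ∀ i j, Q i = true → Q j = true →
        (if δ₁ = 0 then z (Sum.inl i) else if δ₁ = 1 then z (Sum.inr i) else z (Sum.inl i) + z (Sum.inr i)) =
        (if δ₁ = 0 then z (Sum.inl j) else if δ₁ = 1 then z (Sum.inr j) else z (Sum.inl j) + z (Sum.inr j)))
    (hS2 : ∀ z : Fin k ⊕ Fin k → ZMod 2,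
      (∀ i, Q i = false → (d.monskyEvenS *ᵥ z) (Sum.inl i) = 0 ∧ (d.monskyEvenS *ᵥ z) (Sum.inr i) = 0) →
      (∑ i ∈ Finset.univ.filter (fun i => Q i = true), (d.monskyEvenS *ᵥ z) (Sum.inl i)) = 0 →
      (∑ i ∈ Finset.univ.filter (fun i => Q i = true), (d.monskyEvenS *ᵥ z) (Sum.inr i)) = 0 →
      (∀ i, Q i = true →
        (if δ₁ = 0 then (d.monskyEvenS *ᵥ z) (Sum.inl i) else if δ₁ = 1 then (d.monskyEvenS *ᵥ z) (Sum.inr i)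
          else (d.monskyEvenS *ᵥ z) (Sum.inl i) + (d.monskyEvenS *ᵥ z) (Sum.inr i)) = 0) →
      ∀ i j, Q i = true → Q j = true →
        (if δ₂ = 0 then z (Sum.inl i) else if δ₂ = 1 then z (Sum.inr i) else z (Sum.inl i) + z (Sum.inr i)) =
        (if δ₂ = 0 then z (Sum.inl j) else if δ₂ = 1 then z (Sum.inr j) else z (Sum.inl j) + z (Sum.inr j)))
    (hS3 : ∀ z : Fin k ⊕ Fin k → ZMod 2,
      (∀ i j, Q i = true → Q j = true → z (Sum.inl i) = z (Sum.inl j) ∧ z (Sum.inr i) = z (Sum.inr j)) →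
      d.monskyEvenS *ᵥ z = 0 → z = 0) :
    d'.monskyEvenS.det = 1 :=
  det_eq_one_of_staged_constancy Q d.monskyEvenS d'.monskyEvenS (fun z i hi => h.monskyEvenS_mulVec_eq_of_not_mem z i hi)
    (fun z δ hz i _ => h.drow_monskyEvenS_eq z δ hz i) (fun z hz => h.monskyEvenS_mulVec_eq_of_const z hz)
    (fun z => h.sum_monskyEvenS_mulVec_eq z) hδ₁ hδ₂ hne hS1 hS2 hS3

end SymbData

end Summit.BirchSwinnertonDyer.BirchSwinnertonDyer.Theorems.SymbolicMonsky
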